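import Literature.LinearAlgebra.Matrix.PermanentColumnPerturbation
import Mathlib.Logic.Equiv.Prod
import HarnessLib

/-!
# Product laws on rectangular arrays: expectations, Markov, planted rows, Gram concentration

Topic `Probability/Moments`; finite-probability toolkit (weighted `Finset` sums, no measure
theory) continuing `LinearAlgebra/Matrix/PermanentColumnPerturbation.lean` (`arrayWeight`,
`arrayExpect` on square arrays of seeds). Written for the discharge of Aaronson–Arkhipov's Main
Theorem (Theory of Computing 9 (2013), Thm. 1.3; named fact
`Literature.Computability.QuantumComplexity.gpeSolvableInFBPPRel_NPRel_of_approxBosonSamplingOracle`):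
in the "ideal world" of its finite-precision hiding analysis the tall matrix handed to the
BosonSampling oracle has `m × n` entries that are independent functions of disjoint blocks of coin
flips, and the Gaussian input occupies `n` of its rows chosen uniformly at random. Everything here is
proved.

## Results

* `rectWeight`, `rectExpect` — the product law `∏_{r,c} p(ω r c)` on `ω : Fin m → Fin n → A` and its
  expectation functional; linearity, monotonicity, total mass one (`sum_rectWeight`), **Markov's
  inequality** (`rectExpect_indicator_le`), finite Fubini over rows (`sum_rectWeight_mul_prod_rows`).
  The square toolkit `arrayWeight`/`arrayExpect` of `PermanentColumnPerturbation.lean` is the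
  `m = n` instance DEFINITIONALLY (`arrayWeight_eq_rectWeight`, `arrayExpect_eq_rectExpect`, both
  `rfl`); its four basic lemmas (`arrayWeight_nonneg`, `arrayExpect_mono`, `arrayExpect_nonneg`,
  `sum_arrayWeight_mul_prod_rows`) are the square cases of the ones here and should eventually be
  turned into abbreviations of them (librarian pointer; the rectangular versions are the ones to
  keep).
* **`rectExpect_comp_rows`** — planted rows: for injective `S : Fin n → Fin m`, a function of the
  rows `ω (S i)` has under the `m × n` product law the expectation it has under the `n × n` product
  law (`arrayExpect`), so the second-moment bounds of `PermanentColumnPerturbation.lean` apply to the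
  planted block (split the rows with `Equiv.piEquivPiSubtypeProd`, sum out the others, reindex).
* **`rectExpect_norm_gramEntry_sub_sq_le`**, **`rectExpect_exists_gram_far_le`** — concentration of
  the Gram matrix `G j k = ∑ᵣ conj(y(ω r j)) y(ω r k)` (`gramEntry`, `= (Bᴴ B) j k`) of an array with
  i.i.d. MEAN-ZERO entries of second moment `s` and fourth moment `M₄`:
  `E‖G j k - m s δⱼₖ‖² ≤ 4 m (M₄ + s²)` (independent centred rows: only diagonal terms survive) and,
  by Chebyshev and the union bound, `P[∃ j k, a ≤ ‖G j k - m s δⱼₖ‖] ≤ n² · 4m(M₄ + s²)/a²` — the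
  input to the near-orthogonality hypothesis of `Analysis/Matrix/GramSchmidtNearIdentity.lean`
  with `a = t m s`.
* `card_filter_not_injective_le`, `card_filter_not_injective_div_le` — a uniformly random tuple
  `S : Fin n → Fin m` has a collision with probability `≤ n²/m` (`#{S | S i = S j} = m^{n-1}`,
  `card_filter_apply_eq`, and the union bound over pairs).

## References

* S. Arora, B. Barak, *Computational Complexity: A Modern Approach*, CUP 2009, §A.2 (linearity of
  expectation, Markov, Chebyshev, union bound). (Textbook material, proved here in finite form.)
* S. Aaronson, A. Arkhipov, *The computational complexity of linear optics*, Theory of Computing 9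
  (2013) 143–252, §5.2 (the planted submatrix and the symmetry argument).
-/

namespace Literature.Probability.Moments

open Finset Literature.LinearAlgebra.Matrix

section Basic

variable {m n : ℕ} {A : Type*}

/-- The product weight of an `m × n` array of independent seeds: `∏_{r,c} p(ω r c)`. The square
case `m = n` is (definitionally) `arrayWeight` of `PermanentColumnPerturbation.lean`
(`arrayWeight_eq_rectWeight`); the rectangular version is the one to keep. [folklore] -/
def rectWeight (p : A → ℝ) (ω : Fin m → Fin n → A) : ℝ := ∏ r, ∏ c, p (ω r c)

/-- `arrayWeight` (square arrays, `PermanentColumnPerturbation.lean`) is the `m = n` instance of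
`rectWeight`, definitionally. (Librarian pointer: `arrayWeight`/`arrayExpect` and their four basic
lemmas there should become abbreviations of the `rect*` versions here.) [folklore] -/
theorem arrayWeight_eq_rectWeight (p : A → ℝ) (ω : Fin n → Fin n → A) :
    arrayWeight p ω = rectWeight p ω := rfl

/-- Product weights are nonnegative. [folklore] -/
theorem rectWeight_nonneg {p : A → ℝ} (hp : ∀ a, 0 ≤ p a) (ω : Fin m → Fin n → A) :
    0 ≤ rectWeight p ω :=
  Finset.prod_nonneg fun _ _ => Finset.prod_nonneg fun _ _ => hp _

variable [Fintype A]

/-- Expectation under the product law on `m × n` arrays: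
`E_p[F] = ∑_ω (∏_{r,c} p(ω r c)) F(ω)`. The square case `m = n` is (definitionally) `arrayExpect`
of `PermanentColumnPerturbation.lean` (`arrayExpect_eq_rectExpect`). [folklore] -/
def rectExpect (p : A → ℝ) (F : (Fin m → Fin n → A) → ℝ) : ℝ := ∑ ω, rectWeight p ω * F ω

/-- `arrayExpect` (square arrays) is the `m = n` instance of `rectExpect`, definitionally; so every
`rect*` lemma below specialises to the square toolkit by `rw [arrayExpect_eq_rectExpect]`.
[folklore] -/
theorem arrayExpect_eq_rectExpect (p : A → ℝ) (F : (Fin n → Fin n → A) → ℝ) :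
    arrayExpect p F = rectExpect p F := rfl

/-- Monotonicity of the expectation. [folklore] -/
theorem rectExpect_mono {p : A → ℝ} (hp : ∀ a, 0 ≤ p a) {F G : (Fin m → Fin n → A) → ℝ}
    (h : ∀ ω, F ω ≤ G ω) : rectExpect p F ≤ rectExpect p G :=
  Finset.sum_le_sum fun ω _ => mul_le_mul_of_nonneg_left (h ω) (rectWeight_nonneg hp ω)

/-- Nonnegativity of the expectation of a nonnegative function. [folklore] -/
theorem rectExpect_nonneg {p : A → ℝ} (hp : ∀ a, 0 ≤ p a) {F : (Fin m → Fin n → A) → ℝ}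
    (h : ∀ ω, 0 ≤ F ω) : 0 ≤ rectExpect p F :=
  Finset.sum_nonneg fun ω _ => mul_nonneg (rectWeight_nonneg hp ω) (h ω)

/-- Linearity: sums. [folklore] -/
theorem rectExpect_add (p : A → ℝ) (F G : (Fin m → Fin n → A) → ℝ) :
    rectExpect p (fun ω => F ω + G ω) = rectExpect p F + rectExpect p G := by
  unfold rectExpect
  rw [← Finset.sum_add_distrib]
  refine Finset.sum_congr rfl fun ω _ => ?_
  ring

/-- Linearity: scalars. [folklore] -/
theorem rectExpect_smul (p : A → ℝ) (c : ℝ) (F : (Fin m → Fin n → A) → ℝ) :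
    rectExpect p (fun ω => c * F ω) = c * rectExpect p F := by
  unfold rectExpect
  rw [Finset.mul_sum]
  refine Finset.sum_congr rfl fun ω _ => ?_
  ring

/-- Linearity: finite sums. [folklore] -/
theorem rectExpect_sum (p : A → ℝ) {ι : Type*} (s : Finset ι) (F : ι → (Fin m → Fin n → A) → ℝ) :
    rectExpect p (fun ω => ∑ i ∈ s, F i ω) = ∑ i ∈ s, rectExpect p (F i) := by
  unfold rectExpect
  simp_rw [Finset.mul_sum]
  rw [Finset.sum_comm]

/-- **Rows are independent**: the expectation of a product of row functions is the product of the
row expectations (finite Fubini). [folklore] -/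
theorem sum_rectWeight_mul_prod_rows (p : A → ℝ) (φ : Fin m → (Fin n → A) → ℂ) :
    ∑ ω : Fin m → Fin n → A, (rectWeight p ω : ℂ) * ∏ r, φ r (ω r) =
      ∏ r, ∑ row : Fin n → A, ((∏ c, p (row c) : ℝ) : ℂ) * φ r row := by
  rw [Finset.prod_univ_sum]
  simp only [Fintype.piFinset_univ]
  refine Finset.sum_congr rfl fun ω _ => ?_
  rw [rectWeight, Finset.prod_mul_distrib]
  push_cast
  rfl

/-- The total mass is one. [folklore] -/
theorem sum_rectWeight (p : A → ℝ) (hp1 : ∑ a, p a = 1) :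
    ∑ ω : Fin m → Fin n → A, rectWeight p ω = 1 := by
  have h := sum_rectWeight_mul_prod_rows (m := m) (n := n) p (fun _ _ => 1)
  simp only [Finset.prod_const_one, mul_one] at h
  have hrow : ∀ r : Fin m, ∑ row : Fin n → A, ((∏ c, p (row c) : ℝ) : ℂ) = 1 := by
    intro r
    have h2 := sum_rowWeight_mul_prod_cols (n := n) p (fun _ _ => (1 : ℂ))
    simp only [Finset.prod_const_one, mul_one] at h2
    rw [h2]
    have : ∑ a, (p a : ℂ) = 1 := by exact_mod_cast hp1
    rw [this, Finset.prod_const_one]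
  rw [Finset.prod_congr rfl fun r _ => hrow r, Finset.prod_const_one] at h
  exact_mod_cast h

/-- The expectation of a constant. [folklore] -/
theorem rectExpect_const (p : A → ℝ) (hp1 : ∑ a, p a = 1) (c : ℝ) :
    rectExpect p (fun _ : Fin m → Fin n → A => c) = c := by
  unfold rectExpect
  rw [← Finset.sum_mul, sum_rectWeight p hp1, one_mul]

/-- **Markov's inequality** in the finite product form: for `F ≥ 0` and `a > 0`,
`P[a ≤ F] ≤ E[F]/a`. [folklore] -/
theorem rectExpect_indicator_le (p : A → ℝ) (hp : ∀ a, 0 ≤ p a) {F : (Fin m → Fin n → A) → ℝ}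
    (hF : ∀ ω, 0 ≤ F ω) {a : ℝ} (ha : 0 < a) :
    rectExpect p (fun ω => if a ≤ F ω then (1 : ℝ) else 0) ≤ rectExpect p F / a := by
  rw [le_div_iff₀ ha]
  calc rectExpect p (fun ω => if a ≤ F ω then (1 : ℝ) else 0) * a
      = rectExpect p (fun ω => a * (if a ≤ F ω then (1 : ℝ) else 0)) := by
        rw [rectExpect_smul, mul_comm]
    _ ≤ rectExpect p F :=
        rectExpect_mono hp fun ω => by
          split_ifs with h
          · rw [mul_one]; exact h
          · rw [mul_zero]; exact hF ω

end Basic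

/-! ### Planted rows: functions of `n` selected rows see a square product law -/

section Planted

variable {m n : ℕ} {A : Type*} [Fintype A]

/-- **Marginalisation to selected rows.** If `S : Fin n → Fin m` is injective, a function of the
rows `ω (S 0), …, ω (S (n-1))` of an `m × n` array under the product law has the expectation it
has under the product law on `n × n` arrays (`arrayExpect` of
`LinearAlgebra/Matrix/PermanentColumnPerturbation.lean`). [folklore] -/
theorem rectExpect_comp_rows (p : A → ℝ) (hp1 : ∑ a, p a = 1) {S : Fin n → Fin m}
    (hS : Function.Injective S) (F : (Fin n → Fin n → A) → ℝ) :
    rectExpect p (fun ω : Fin m → Fin n → A => F fun i => ω (S i)) = arrayExpect p F := by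
  classical
  -- split the rows into the selected ones and the rest
  let P : Fin m → Prop := fun r => ∃ i, S i = r
  let e := Equiv.piEquivPiSubtypeProd P (fun _ : Fin m => Fin n → A)
  -- the bijection between `Fin n` and the selected rows
  let Sh : Fin n → {r // P r} := fun i => ⟨S i, ⟨i, rfl⟩⟩
  have hSh : Function.Bijective Sh := by
    refine ⟨fun i j h => hS (congrArg Subtype.val h), fun ⟨r, ⟨i, hi⟩⟩ => ⟨i, Subtype.ext hi⟩⟩
  let eS : Fin n ≃ {r // P r} := Equiv.ofBijective Sh hSh
  unfold rectExpect arrayExpect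
  rw [← Fintype.sum_equiv e.symm (fun uv => rectWeight p (e.symm uv) * F fun i => (e.symm uv) (S i))
    (fun ω => rectWeight p ω * F fun i => ω (S i)) (fun _ => rfl)]
  rw [Fintype.sum_prod_type]
  -- the integrand factors: weight = (weight of selected rows) * (weight of the rest)
  have hsplit : ∀ (u : {r // P r} → Fin n → A) (v : {r // ¬P r} → Fin n → A),
      rectWeight p (e.symm (u, v)) = (∏ r : {r // P r}, ∏ c, p (u r c)) *
        ∏ r : {r // ¬P r}, ∏ c, p (v r c) := by
    intro u v
    rw [rectWeight, ← Fintype.prod_subtype_mul_prod_subtype P (fun r => ∏ c, p ((e.symm (u, v)) r c))]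
    congr 1
    · refine Finset.prod_congr rfl fun r _ => ?_
      simp [e, Equiv.piEquivPiSubtypeProd_symm_apply, r.2]
    · refine Finset.prod_congr rfl fun r _ => ?_
      simp [e, Equiv.piEquivPiSubtypeProd_symm_apply, r.2]
  have hF : ∀ (u : {r // P r} → Fin n → A) (v : {r // ¬P r} → Fin n → A),
      (F fun i => (e.symm (u, v)) (S i)) = F fun i => u (Sh i) := by
    intro u v
    congr 1
    funext i
    have hi : P (S i) := ⟨i, rfl⟩
    simp [e, Equiv.piEquivPiSubtypeProd_symm_apply, hi, Sh]
  simp_rw [hsplit, hF]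
  -- sum out the unselected rows
  have hrest : ∑ v : {r // ¬P r} → Fin n → A, ∏ r : {r // ¬P r}, ∏ c, p (v r c) = 1 := by
    rw [← Fintype.piFinset_univ, ← Finset.prod_univ_sum (t := fun _ => univ)
      (f := fun (_ : {r // ¬P r}) (row : Fin n → A) => ∏ c, p (row c))]
    refine Finset.prod_eq_one fun r _ => ?_
    rw [← Fintype.piFinset_univ, ← Finset.prod_univ_sum (t := fun _ => univ)
      (f := fun (_ : Fin n) (a : A) => p a)]
    exact Finset.prod_eq_one fun c _ => hp1
  have hinner : ∀ u : {r // P r} → Fin n → A,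
      ∑ v : {r // ¬P r} → Fin n → A, (∏ r : {r // P r}, ∏ c, p (u r c)) *
        (∏ r : {r // ¬P r}, ∏ c, p (v r c)) * F (fun i => u (Sh i)) =
        (∏ r : {r // P r}, ∏ c, p (u r c)) * F (fun i => u (Sh i)) := by
    intro u
    rw [← Finset.sum_mul, ← Finset.mul_sum, hrest, mul_one]
  simp_rw [hinner]
  -- reindex the selected rows by `Fin n`
  refine Fintype.sum_equiv (Equiv.piCongrLeft' (fun _ => Fin n → A) eS.symm)
    _ _ fun u => ?_
  have hu : ∀ i, (Equiv.piCongrLeft' (fun _ => Fin n → A) eS.symm) u i = u (Sh i) := by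
    intro i
    rw [Equiv.piCongrLeft'_apply, Equiv.symm_symm]
    rfl
  rw [show (Equiv.piCongrLeft' (fun _ => Fin n → A) eS.symm) u = fun i => u (Sh i) from funext hu]
  congr 1
  rw [arrayWeight]
  exact (Fintype.prod_bijective Sh hSh (fun i => ∏ c, p (u (Sh i) c)) (fun r => ∏ c, p (u r c))
    (fun _ => rfl)).symm

end Planted

/-! ### Concentration of the Gram matrix of an array with i.i.d. mean-zero entries -/

section Gram

variable {m n : ℕ} {A : Type*} [Fintype A]

/-- The Gram entry `G j k = ∑ᵣ conj(y(ω r j)) · y(ω r k)` of the matrix of entries read off an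
array of seeds (`= (Bᴴ B) j k` for `B r c = y (ω r c)`). [folklore] -/
def gramEntry (y : A → ℂ) (ω : Fin m → Fin n → A) (j k : Fin n) : ℂ :=
  ∑ r, (starRingEnd ℂ) (y (ω r j)) * y (ω r k)

/-- Entries of a row are independent: real-valued version of the factorisation inside one row.
[folklore] -/
theorem sum_rowWeight_mul_prod_cols_real (p : A → ℝ) (ψ : Fin n → A → ℝ) :
    ∑ row : Fin n → A, (∏ c, p (row c)) * ∏ c, ψ c (row c) = ∏ c, ∑ a, p a * ψ c a := by
  rw [Finset.prod_univ_sum]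
  simp only [Fintype.piFinset_univ]
  refine Finset.sum_congr rfl fun row _ => ?_
  rw [← Finset.prod_mul_distrib]

/-- The row weights sum to one. [folklore] -/
theorem sum_rowWeight (p : A → ℝ) (hp1 : ∑ a, p a = 1) :
    ∑ row : Fin n → A, (∏ c, p (row c)) = 1 := by
  have h := sum_rowWeight_mul_prod_cols_real (n := n) p (fun _ _ => 1)
  simp only [Finset.prod_const_one, mul_one] at h
  rw [h, Finset.prod_eq_one fun c _ => hp1]

/-- **One row of the Gram entry is centred**: `E[conj(y(row j)) y(row k)] = s δⱼₖ`. [folklore] -/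
theorem sum_rowWeight_mul_conj_mul (p : A → ℝ) (hp1 : ∑ a, p a = 1) (y : A → ℂ)
    (hy : ∑ a, (p a : ℂ) * y a = 0) {s : ℝ} (hs : ∑ a, p a * ‖y a‖ ^ 2 = s) (j k : Fin n) :
    ∑ row : Fin n → A, ((∏ c, p (row c) : ℝ) : ℂ) *
        ((starRingEnd ℂ) (y (row j)) * y (row k)) = if j = k then (s : ℂ) else 0 := by
  have h := sum_rowWeight_mul_entry_mul_conj (n := n) p hp1 y hy hs k j
  simp_rw [mul_comm (y _) ((starRingEnd ℂ) _)] at h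
  rw [h]
  by_cases hjk : j = k
  · rw [if_pos hjk, if_pos hjk.symm]
  · rw [if_neg hjk, if_neg (Ne.symm hjk)]

/-- **Fourth-moment bound for one row**: `E[‖y(row j)‖² ‖y(row k)‖²] ≤ M₄ + s²`
(`= s²` off the diagonal, `= M₄` on it). [folklore] -/
theorem sum_rowWeight_mul_norm_sq_mul_norm_sq_le (p : A → ℝ) (hp : ∀ a, 0 ≤ p a)
    (hp1 : ∑ a, p a = 1) (y : A → ℂ) {s M4 : ℝ} (hs : ∑ a, p a * ‖y a‖ ^ 2 = s)
    (hM4 : ∑ a, p a * ‖y a‖ ^ 4 = M4) (j k : Fin n) :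
    ∑ row : Fin n → A, (∏ c, p (row c)) * (‖y (row j)‖ ^ 2 * ‖y (row k)‖ ^ 2) ≤ M4 + s ^ 2 := by
  have hs0 : 0 ≤ s := by rw [← hs]; exact Finset.sum_nonneg fun a _ => mul_nonneg (hp a) (by positivity)
  have hM40 : 0 ≤ M4 := by rw [← hM4]; exact Finset.sum_nonneg fun a _ => mul_nonneg (hp a) (by positivity)
  set ψ : Fin n → A → ℝ := fun c a =>
    (if c = j then ‖y a‖ ^ 2 else 1) * (if c = k then ‖y a‖ ^ 2 else 1) with hψ
  have hprod : ∀ row : Fin n → A, ‖y (row j)‖ ^ 2 * ‖y (row k)‖ ^ 2 = ∏ c, ψ c (row c) := by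
    intro row
    simp only [hψ, Finset.prod_mul_distrib, Finset.prod_ite_eq', mem_univ, if_true]
  simp_rw [hprod, sum_rowWeight_mul_prod_cols_real]
  have hone : ∀ c, c ≠ j → c ≠ k → ∑ a, p a * ψ c a = 1 := by
    intro c hcj hck
    simp only [hψ, if_neg hcj, if_neg hck, mul_one]
    exact hp1
  by_cases hjk : j = k
  · subst hjk
    rw [← Finset.mul_prod_erase univ _ (mem_univ j)]
    have hj : ∑ a, p a * ψ j a = M4 := by
      simp only [hψ, if_true]
      rw [← hM4]
      refine Finset.sum_congr rfl fun a _ => ?_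
      ring
    rw [hj, Finset.prod_congr rfl fun c hc => hone c (ne_of_mem_erase hc) (ne_of_mem_erase hc),
      Finset.prod_const_one, mul_one]
    nlinarith
  · rw [← Finset.mul_prod_erase univ _ (mem_univ j),
      ← Finset.mul_prod_erase (univ.erase j) _ (mem_erase.2 ⟨Ne.symm hjk, mem_univ k⟩)]
    have hj : ∑ a, p a * ψ j a = s := by
      simp only [hψ, if_true, if_neg hjk, mul_one]
      exact hs
    have hk : ∑ a, p a * ψ k a = s := by
      simp only [hψ, if_true, if_neg (Ne.symm hjk), one_mul]
      exact hs
    rw [hj, hk, Finset.prod_congr rfl fun c hc => hone c (ne_of_mem_erase (mem_of_mem_erase hc))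
      (ne_of_mem_erase hc), Finset.prod_const_one, mul_one]
    nlinarith

/-- **Second moment of a Gram entry.** Under the product law with mean-zero entries of second
moment `s` and fourth moment `M₄`:
`E‖G j k - m s δⱼₖ‖² ≤ 4 m (M₄ + s²)` — the `m` rows are independent and centred, so only the
diagonal terms `r = r'` of `‖∑ᵣ tᵣ‖²` survive, each `≤ 2 E‖u‖² + 2 s² ≤ 4 (M₄ + s²)`. [folklore] -/
theorem rectExpect_norm_gramEntry_sub_sq_le (p : A → ℝ) (hp : ∀ a, 0 ≤ p a) (hp1 : ∑ a, p a = 1)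
    (y : A → ℂ) (hy : ∑ a, (p a : ℂ) * y a = 0) {s M4 : ℝ} (hs : ∑ a, p a * ‖y a‖ ^ 2 = s)
    (hM4 : ∑ a, p a * ‖y a‖ ^ 4 = M4) (j k : Fin n) :
    rectExpect p (fun ω : Fin m → Fin n → A =>
        ‖gramEntry y ω j k - (if j = k then (m * s : ℂ) else 0)‖ ^ 2) ≤ 4 * m * (M4 + s ^ 2) := by
  have hs0 : 0 ≤ s := by rw [← hs]; exact Finset.sum_nonneg fun a _ => mul_nonneg (hp a) (by positivity)
  have hM40 : 0 ≤ M4 := by rw [← hM4]; exact Finset.sum_nonneg fun a _ => mul_nonneg (hp a) (by positivity)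
  -- the centred row term
  set c0 : ℂ := if j = k then (s : ℂ) else 0 with hc0
  set t : (Fin n → A) → ℂ := fun row => (starRingEnd ℂ) (y (row j)) * y (row k) - c0 with ht
  have hdecomp : ∀ ω : Fin m → Fin n → A,
      gramEntry y ω j k - (if j = k then (m * s : ℂ) else 0) = ∑ r, t (ω r) := by
    intro ω
    simp only [ht, gramEntry, Finset.sum_sub_distrib, Finset.sum_const, card_univ, Fintype.card_fin,
      nsmul_eq_mul, hc0]
    split_ifs <;> simp
  -- row expectations of `t`
  have hrowW1 : ∑ row : Fin n → A, ((∏ c, p (row c) : ℝ) : ℂ) = 1 := by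
    exact_mod_cast sum_rowWeight (n := n) p hp1
  have hEt : ∑ row : Fin n → A, ((∏ c, p (row c) : ℝ) : ℂ) * t row = 0 := by
    simp only [ht, mul_sub, Finset.sum_sub_distrib]
    rw [sum_rowWeight_mul_conj_mul p hp1 y hy hs j k, ← Finset.sum_mul, hrowW1, one_mul, hc0, sub_self]
  have hc0norm : ‖c0‖ ^ 2 ≤ s ^ 2 := by
    rw [hc0]; split_ifs
    · rw [Complex.norm_real, Real.norm_eq_abs, sq_abs]
    · rw [norm_zero, zero_pow two_ne_zero]; positivity
  have hEtt : (∑ row : Fin n → A, (∏ c, p (row c)) * ‖t row‖ ^ 2) ≤ 4 * (M4 + s ^ 2) := by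
    have hpt : ∀ row : Fin n → A, ‖t row‖ ^ 2 ≤
        2 * (‖y (row j)‖ ^ 2 * ‖y (row k)‖ ^ 2) + 2 * s ^ 2 := by
      intro row
      have h1 : ‖t row‖ ≤ ‖(starRingEnd ℂ) (y (row j)) * y (row k)‖ + ‖c0‖ := norm_sub_le _ _
      rw [norm_mul, RCLike.norm_conj] at h1
      have h3 : ‖t row‖ ^ 2 ≤ (‖y (row j)‖ * ‖y (row k)‖ + ‖c0‖) ^ 2 :=
        pow_le_pow_left₀ (norm_nonneg _) h1 2
      have h4 : (‖y (row j)‖ * ‖y (row k)‖ + ‖c0‖) ^ 2 ≤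
          2 * (‖y (row j)‖ ^ 2 * ‖y (row k)‖ ^ 2) + 2 * ‖c0‖ ^ 2 := by
        nlinarith [sq_nonneg (‖y (row j)‖ * ‖y (row k)‖ - ‖c0‖)]
      linarith
    calc (∑ row : Fin n → A, (∏ c, p (row c)) * ‖t row‖ ^ 2)
        ≤ ∑ row : Fin n → A, (∏ c, p (row c)) *
            (2 * (‖y (row j)‖ ^ 2 * ‖y (row k)‖ ^ 2) + 2 * s ^ 2) :=
          Finset.sum_le_sum fun row _ => mul_le_mul_of_nonneg_left (hpt row)
            (Finset.prod_nonneg fun c _ => hp _)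
      _ = 2 * (∑ row : Fin n → A, (∏ c, p (row c)) * (‖y (row j)‖ ^ 2 * ‖y (row k)‖ ^ 2)) +
            2 * s ^ 2 * ∑ row : Fin n → A, (∏ c, p (row c)) := by
          rw [Finset.mul_sum, Finset.mul_sum, ← Finset.sum_add_distrib]
          refine Finset.sum_congr rfl fun row _ => ?_
          ring
      _ ≤ 2 * (M4 + s ^ 2) + 2 * s ^ 2 * 1 := by
          rw [sum_rowWeight p hp1]
          have := sum_rowWeight_mul_norm_sq_mul_norm_sq_le p hp hp1 y hs hM4 j k
          nlinarith
      _ ≤ 4 * (M4 + s ^ 2) := by nlinarith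
  -- the complex computation of `E‖∑ t‖²`
  have hC : (rectExpect p (fun ω : Fin m → Fin n → A =>
      ‖gramEntry y ω j k - (if j = k then (m * s : ℂ) else 0)‖ ^ 2) : ℂ) =
      (m : ℂ) * ∑ row : Fin n → A, ((∏ c, p (row c) : ℝ) : ℂ) * (t row * (starRingEnd ℂ) (t row)) := by
    unfold rectExpect
    rw [Complex.ofReal_sum]
    simp_rw [Complex.ofReal_mul, hdecomp]
    have hsq : ∀ ω : Fin m → Fin n → A, (((‖∑ r, t (ω r)‖ ^ 2 : ℝ)) : ℂ) =
        ∑ r, ∑ r', t (ω r) * (starRingEnd ℂ) (t (ω r')) := by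
      intro ω
      rw [← Complex.normSq_eq_norm_sq, ← Complex.mul_conj, map_sum, Finset.sum_mul_sum]
    simp_rw [hsq, Finset.mul_sum]
    -- each `(r, r')` term
    have hterm : ∀ r r' : Fin m,
        ∑ ω : Fin m → Fin n → A, (rectWeight p ω : ℂ) * (t (ω r) * (starRingEnd ℂ) (t (ω r'))) =
          if r = r' then ∑ row : Fin n → A, ((∏ c, p (row c) : ℝ) : ℂ) *
            (t row * (starRingEnd ℂ) (t row)) else 0 := by
      intro r r'
      set φ : Fin m → (Fin n → A) → ℂ := fun x row =>
        (if x = r then t row else 1) * (if x = r' then (starRingEnd ℂ) (t row) else 1) with hφ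
      have hprod : ∀ ω : Fin m → Fin n → A,
          t (ω r) * (starRingEnd ℂ) (t (ω r')) = ∏ x, φ x (ω x) := by
        intro ω
        simp only [hφ, Finset.prod_mul_distrib, Finset.prod_ite_eq', mem_univ, if_true]
      simp_rw [hprod, sum_rectWeight_mul_prod_rows]
      have hone : ∀ x, x ≠ r → x ≠ r' →
          ∑ row : Fin n → A, ((∏ c, p (row c) : ℝ) : ℂ) * φ x row = 1 := by
        intro x hxr hxr'
        simp only [hφ, if_neg hxr, if_neg hxr', mul_one]
        exact hrowW1
      by_cases hrr : r = r'
      · subst hrr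
        rw [if_pos rfl, ← Finset.mul_prod_erase univ _ (mem_univ r)]
        have hr : ∑ row : Fin n → A, ((∏ c, p (row c) : ℝ) : ℂ) * φ r row =
            ∑ row : Fin n → A, ((∏ c, p (row c) : ℝ) : ℂ) * (t row * (starRingEnd ℂ) (t row)) := by
          simp only [hφ, if_true]
        rw [hr, Finset.prod_congr rfl fun x hx => hone x (ne_of_mem_erase hx) (ne_of_mem_erase hx),
          Finset.prod_const_one, mul_one]
      · rw [if_neg hrr]
        apply Finset.prod_eq_zero (mem_univ r)
        simp only [hφ, if_true, if_neg hrr, mul_one]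
        exact hEt
    rw [Finset.sum_comm]
    have h2 : ∀ r : Fin m,
        ∑ ω : Fin m → Fin n → A, ∑ r', (rectWeight p ω : ℂ) * (t (ω r) * (starRingEnd ℂ) (t (ω r'))) =
          ∑ r' : Fin m, (if r = r' then ∑ row : Fin n → A, ((∏ c, p (row c) : ℝ) : ℂ) *
            (t row * (starRingEnd ℂ) (t row)) else 0) := by
      intro r
      rw [Finset.sum_comm]
      exact Finset.sum_congr rfl fun r' _ => hterm r r'
    rw [Finset.sum_congr rfl fun r _ => h2 r]
    simp only [Finset.sum_ite_eq, mem_univ, if_true, Finset.sum_const, card_univ, Fintype.card_fin,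
      nsmul_eq_mul]
    rw [Finset.mul_sum]
  -- back to the reals
  have hR : rectExpect p (fun ω : Fin m → Fin n → A =>
      ‖gramEntry y ω j k - (if j = k then (m * s : ℂ) else 0)‖ ^ 2) =
      m * ∑ row : Fin n → A, (∏ c, p (row c)) * ‖t row‖ ^ 2 := by
    have : ((m * ∑ row : Fin n → A, (∏ c, p (row c)) * ‖t row‖ ^ 2 : ℝ) : ℂ) =
        (m : ℂ) * ∑ row : Fin n → A, ((∏ c, p (row c) : ℝ) : ℂ) * (t row * (starRingEnd ℂ) (t row)) := by
      push_cast
      congr 1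
      refine Finset.sum_congr rfl fun row _ => ?_
      rw [Complex.mul_conj, Complex.normSq_eq_norm_sq]
      push_cast
      ring
    exact_mod_cast hC.trans this.symm
  rw [hR]
  calc (m : ℝ) * ∑ row : Fin n → A, (∏ c, p (row c)) * ‖t row‖ ^ 2
      ≤ m * (4 * (M4 + s ^ 2)) := mul_le_mul_of_nonneg_left hEtt (Nat.cast_nonneg m)
    _ = 4 * m * (M4 + s ^ 2) := by ring

/-- **Concentration of the Gram matrix** (Chebyshev and the union bound): for `a > 0`,
`P[∃ j k, a ≤ ‖G j k - m s δⱼₖ‖] ≤ n² · 4 m (M₄ + s²) / a²`. [folklore] -/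
theorem rectExpect_exists_gram_far_le (p : A → ℝ) (hp : ∀ a, 0 ≤ p a) (hp1 : ∑ a, p a = 1)
    (y : A → ℂ) (hy : ∑ a, (p a : ℂ) * y a = 0) {s M4 : ℝ} (hs : ∑ a, p a * ‖y a‖ ^ 2 = s)
    (hM4 : ∑ a, p a * ‖y a‖ ^ 4 = M4) {a : ℝ} (ha : 0 < a) :
    rectExpect p (fun ω : Fin m → Fin n → A =>
        if ∃ j k : Fin n, a ≤ ‖gramEntry y ω j k - (if j = k then (m * s : ℂ) else 0)‖
        then (1 : ℝ) else 0) ≤ (n : ℝ) ^ 2 * (4 * m * (M4 + s ^ 2)) / a ^ 2 := by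
  classical
  -- union bound, pointwise
  have hub : ∀ ω : Fin m → Fin n → A,
      (if ∃ j k : Fin n, a ≤ ‖gramEntry y ω j k - (if j = k then (m * s : ℂ) else 0)‖
        then (1 : ℝ) else 0) ≤
      ∑ j, ∑ k, (if a ^ 2 ≤ ‖gramEntry y ω j k - (if j = k then (m * s : ℂ) else 0)‖ ^ 2
        then (1 : ℝ) else 0) := by
    intro ω
    split_ifs with h
    · obtain ⟨j, k, hjk⟩ := h
      have hjk' : a ^ 2 ≤ ‖gramEntry y ω j k - (if j = k then (m * s : ℂ) else 0)‖ ^ 2 :=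
        pow_le_pow_left₀ ha.le hjk 2
      calc (1 : ℝ) = if a ^ 2 ≤ ‖gramEntry y ω j k - (if j = k then (m * s : ℂ) else 0)‖ ^ 2
            then (1 : ℝ) else 0 := by rw [if_pos hjk']
        _ ≤ ∑ k', (if a ^ 2 ≤ ‖gramEntry y ω j k' - (if j = k' then (m * s : ℂ) else 0)‖ ^ 2
            then (1 : ℝ) else 0) :=
          Finset.single_le_sum (f := fun k' => if a ^ 2 ≤
            ‖gramEntry y ω j k' - (if j = k' then (m * s : ℂ) else 0)‖ ^ 2 then (1 : ℝ) else 0)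
            (fun k' _ => by split_ifs <;> norm_num) (mem_univ k)
        _ ≤ ∑ j', ∑ k', (if a ^ 2 ≤ ‖gramEntry y ω j' k' - (if j' = k' then (m * s : ℂ) else 0)‖ ^ 2
            then (1 : ℝ) else 0) :=
          Finset.single_le_sum (f := fun j' => ∑ k', (if a ^ 2 ≤
            ‖gramEntry y ω j' k' - (if j' = k' then (m * s : ℂ) else 0)‖ ^ 2 then (1 : ℝ) else 0))
            (fun j' _ => Finset.sum_nonneg fun k' _ => by split_ifs <;> norm_num) (mem_univ j)
    · exact Finset.sum_nonneg fun j _ => Finset.sum_nonneg fun k _ => by split_ifs <;> norm_num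
  refine (rectExpect_mono hp hub).trans ?_
  rw [rectExpect_sum]
  simp_rw [rectExpect_sum]
  have hterm : ∀ j k : Fin n, rectExpect p (fun ω : Fin m → Fin n → A =>
      if a ^ 2 ≤ ‖gramEntry y ω j k - (if j = k then (m * s : ℂ) else 0)‖ ^ 2 then (1 : ℝ) else 0) ≤
      4 * m * (M4 + s ^ 2) / a ^ 2 := by
    intro j k
    refine (rectExpect_indicator_le p hp (fun ω => by positivity) (by positivity)).trans ?_
    exact div_le_div_of_nonneg_right (rectExpect_norm_gramEntry_sub_sq_le p hp hp1 y hy hs hM4 j k)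
      (by positivity)
  calc ∑ j, ∑ k, rectExpect p (fun ω : Fin m → Fin n → A =>
        if a ^ 2 ≤ ‖gramEntry y ω j k - (if j = k then (m * s : ℂ) else 0)‖ ^ 2 then (1 : ℝ) else 0)
      ≤ ∑ _j : Fin n, ∑ _k : Fin n, 4 * m * (M4 + s ^ 2) / a ^ 2 :=
        Finset.sum_le_sum fun j _ => Finset.sum_le_sum fun k _ => hterm j k
    _ = (n : ℝ) ^ 2 * (4 * m * (M4 + s ^ 2)) / a ^ 2 := by
        rw [Finset.sum_const, Finset.sum_const, card_univ, Fintype.card_fin, nsmul_eq_mul, nsmul_eq_mul]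
        ring

end Gram

/-! ### Collisions of a uniformly random tuple of row indices -/

section Collision

variable {m n : ℕ}

/-- Tuples with a prescribed collision `S i = S j` (`i ≠ j`) are parametrised by their values off
`i`: there are exactly `m^{n-1}` of them. [folklore] -/
theorem card_filter_apply_eq {i j : Fin n} (hij : i ≠ j) :
    (univ.filter fun S : Fin n → Fin m => S i = S j).card = m ^ (n - 1) := by
  classical
  -- the values off `i` determine such a tuple
  let e : {S : Fin n → Fin m // S i = S j} ≃ ({x : Fin n // x ≠ i} → Fin m) :=
    { toFun := fun S x => S.1 x
      invFun := fun f => ⟨fun x => if h : x = i then f ⟨j, hij.symm⟩ else f ⟨x, h⟩, by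
        simp [hij.symm]⟩
      left_inv := by
        rintro ⟨S, hS⟩
        ext x
        by_cases h : x = i
        · subst h; simp [hS]
        · simp [h]
      right_inv := by
        intro f
        funext ⟨x, hx⟩
        simp [hx] }
  rw [← Fintype.card_subtype, Fintype.card_congr e, Fintype.card_fun, Fintype.card_fin,
    Fintype.card_subtype_compl, Fintype.card_fin, Fintype.card_unique]

/-- **Few tuples collide**: the number of non-injective `S : Fin n → Fin m` is at most
`n² · m^{n-1}` (union over the pairs `i ≠ j`). [folklore] -/
theorem card_filter_not_injective_le :
    ((univ.filter fun S : Fin n → Fin m => ¬ Function.Injective S).card : ℝ) ≤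
      (n : ℝ) ^ 2 * (m : ℝ) ^ (n - 1) := by
  classical
  have hsub : (univ.filter fun S : Fin n → Fin m => ¬ Function.Injective S) ⊆
      (univ.filter fun ij : Fin n × Fin n => ij.1 ≠ ij.2).biUnion
        fun ij => univ.filter fun S : Fin n → Fin m => S ij.1 = S ij.2 := by
    intro S hS
    simp only [mem_filter, mem_univ, true_and, Function.Injective, not_forall] at hS
    obtain ⟨a, b, hab, hne⟩ := hS
    simp only [mem_biUnion, mem_filter, mem_univ, true_and]
    exact ⟨(a, b), hne, hab⟩
  calc ((univ.filter fun S : Fin n → Fin m => ¬ Function.Injective S).card : ℝ)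
      ≤ ((univ.filter fun ij : Fin n × Fin n => ij.1 ≠ ij.2).biUnion
          fun ij => univ.filter fun S : Fin n → Fin m => S ij.1 = S ij.2).card := by
        exact_mod_cast card_le_card hsub
    _ ≤ ∑ ij ∈ univ.filter (fun ij : Fin n × Fin n => ij.1 ≠ ij.2),
          ((univ.filter fun S : Fin n → Fin m => S ij.1 = S ij.2).card : ℝ) := by
        exact_mod_cast card_biUnion_le
    _ = ∑ _ij ∈ univ.filter (fun ij : Fin n × Fin n => ij.1 ≠ ij.2), ((m : ℝ) ^ (n - 1)) := by
        refine Finset.sum_congr rfl fun ij hij => ?_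
        rw [mem_filter] at hij
        rw [card_filter_apply_eq hij.2]
        push_cast
        ring
    _ ≤ ∑ _ij : Fin n × Fin n, ((m : ℝ) ^ (n - 1)) :=
        Finset.sum_le_sum_of_subset_of_nonneg (filter_subset _ _) fun _ _ _ => by positivity
    _ = (n : ℝ) ^ 2 * (m : ℝ) ^ (n - 1) := by
        rw [Finset.sum_const, card_univ, Fintype.card_prod, Fintype.card_fin, nsmul_eq_mul]
        push_cast
        ring

/-- In probability form: a uniformly random `S : Fin n → Fin m` (`m ≥ 1`) fails to be injective
with probability at most `n²/m`. [folklore] -/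
theorem card_filter_not_injective_div_le (hm : 0 < m) :
    ((univ.filter fun S : Fin n → Fin m => ¬ Function.Injective S).card : ℝ) / (m : ℝ) ^ n ≤
      (n : ℝ) ^ 2 / m := by
  classical
  have hmR : (0 : ℝ) < m := by exact_mod_cast hm
  rcases Nat.eq_zero_or_pos n with hn | hn
  · subst hn
    have : (univ.filter fun S : Fin 0 → Fin m => ¬ Function.Injective S) = ∅ := by
      ext S
      simp only [mem_filter, mem_univ, true_and, Finset.notMem_empty, iff_false, not_not]
      exact fun a b _ => Fin.elim0 a
    rw [this, card_empty]
    simp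
  rw [div_le_div_iff₀ (by positivity) hmR]
  calc ((univ.filter fun S : Fin n → Fin m => ¬ Function.Injective S).card : ℝ) * m
      ≤ (n : ℝ) ^ 2 * (m : ℝ) ^ (n - 1) * m :=
        mul_le_mul_of_nonneg_right card_filter_not_injective_le hmR.le
    _ = (n : ℝ) ^ 2 * ((m : ℝ) ^ (n - 1) * m) := by ring
    _ = (n : ℝ) ^ 2 * (m : ℝ) ^ n := by
        rw [← pow_succ, Nat.sub_add_cancel hn]

end Collision

end Literature.Probability.Moments
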